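import Summits.CriticalPhenomena.CardyFormulaZ2.Theorems.CardySusyWardWeakHolomorphyReduction

/-!
# The crux `CardySusyWard.WeakHolomorphy` IS the weak Kirchhoff law of the spin-`1/3` dart observable, tested against `∂φ`

Line `Sketch` of the crux `CardySusyWard.WeakHolomorphy` (stmt-CriticalPhenomena-11292), lead c3 (infrastructure,
`--supports`).  The landed bypass closes the crux from the `L¹` Kirchhoff law (`weakHolomorphy_of_kirchhoffL1`, p137519).
Here the bookkeeping of the bypass is read as an IDENTITY rather than an estimate: at one mesh, with the weights
`w(p,k)` of the MASTER identity (`sum_weight_expand`), the dart observable `Fd = bondDartObservable (Λ δ) δ (1/3)` and the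
finite set `S` of `stub_count`,
  `Σ_z F_δ(z) ∂̄φ(z_δ) = κ · [ Σ_{p∈S} Σ_k w(p,k) Fd(c_{p,k}) − i Σ_p ∂φ(z_p)·(Fd(NE)+Fd(SW)−Fd(NW)−Fd(SE))(p)
      + (2(1−i)/δ) Σ_p φ(z_p)·halfCRForm i p Fd ]`,
where the first bracket term is `O(1)` by the twin regrouping and the Taylor bound (`master_norm_bound`, `stub_regroup`,
`stub_taylorComb`, `stub_calculus`, `stub_count`) and the last term VANISHES eventually (exact vertex relation `stub_halfCR`
in the interior branch of `stub_bulkDichotomy`, nothing traversed in the other).  Hence, along every admissible family and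
for every test function, `δ^{5/3} Σ_z F_δ(z) ∂̄φ(z_δ) → 0` if and only if `δ^{5/3} Σ_p ∂φ(z_p)·K^s_p → 0`, `K^s_p` the signed
(sublattice-staggered) Kirchhoff defect `Fd(NE)+Fd(SW)−Fd(NW)−Fd(SE)` (`weakKirchhoff_tendsto_iff`), and
`WeakHolomorphy ↔ WeakKirchhoff` (`weakHolomorphy_iff_weakKirchhoff`): the crux is EXACTLY the weak, `∂φ`-tested,
staggered Kirchhoff law at the rate `o(δ^{-5/3})` — the `L¹` laws of the registered stubs are sufficient conditions with
room.  (Crux-workfile precedent: `Cruxes/WeakHolomorphy/Disproof.lean` §D, `weakHolomorphy_iff_staggeredEntry_of_vertexRelation`,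
for Smirnov's entry observable and conditional on exact vertex relations; here for the dart observable and unconditional.)
References: Duminil-Copin–Smirnov arXiv:1109.1549 §8.3, Conj. 8.7; Duminil-Copin arXiv:1208.3787 Prop. 4.
-/

noncomputable section

namespace Summit.CriticalPhenomena.CardyFormulaZ2.Theorems.WeakHolomorphy.SplitBypass

open scoped BigOperators Topology
open Filter Set MeasureTheory Complex
open _root_.Literature.Probability.LatticeModels
open _root_.Literature.Probability.RandomPlanarGeometry (DobrushinDomain)
open _root_.Literature.Probability.Percolation (BondConfig bondPercolation half)
open _root_.Literature.Barriers.CriticalPhenomena (medialCornersAt medialVertexOf halfCRForm HalfCRRelationAt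
  halfCRForm_apply halfCRRelationAt_iff)
open _root_.Literature.Barriers.CriticalPhenomena.HalfCRGreen (coeff twin)
open Summit.CriticalPhenomena.CardyFormulaZ2.Theorems.ParafermionPrecompact.Negative (F IsFamily)
open Summit.CriticalPhenomena.CardyFormulaZ2.Cruxes.ParafermionPrecompact.KenyonStreamSecondRelation (kappa_pos_le)
open Summit.CriticalPhenomena.CardyFormulaZ2.Cruxes.EdgePrecompact.QkzStripBoundaryArm (cornerObs cornerObs_eq_bondDartObservable)

/-! ## Exact vanishing of the vertex-relation term above a compact set -/

/-- **The vertex relation is EXACT above every compact, eventually** (not only small in `L¹`): along an admissible family,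
eventually in `δ`, `halfCRForm i p Fd = 0` at every medial vertex `p` whose point lies in `K` (`stub_halfCR` in the interior
branch of the bulk dichotomy; all four corner values vanish in the other). [cite: DuminilCopin2012Parafermion, Proposition 4] -/
theorem halfCRForm_eq_zero_eventually (D : DobrushinDomain) (Λ : ℝ → DiscreteDobrushin) (hΛ : IsFamily D Λ)
    (K : Set ℂ) (hK : IsCompact K) (hKD : K ⊆ D.carrier) :
    ∀ᶠ δ in 𝓝[>] (0:ℝ), ∀ p : Site 2 × Fin 2, medialPoint δ (medialVertexOf p) ∈ K →
      halfCRForm Complex.I p (fun c => bondDartObservable (Λ δ) δ (1 / 3) c) = 0 := by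
  have hadm := hΛ.2.2.2.2.2
  filter_upwards [stub_bulkDichotomy D Λ hΛ K hK hKD, hadm, self_mem_nhdsWithin] with δ hdich hA hδpos p hp
  have hδ0 : (0:ℝ) < δ := hδpos
  rcases hdich with hint | hvan
  · have hHF : HoleFree {f : Site 2 | (Λ δ).IsInnerFace f} :=
      holeFree_innerFaces D.toJordanDomain (hΛ.1 δ) (by rw [hΛ.2.1 δ]; exact hδ0)
    have h := stub_halfCR (Λ δ) hA hHF p (hint p hp) δ hδ0
    rw [halfCRRelationAt_iff] at h
    have hfun : (fun c : Site 2 × Site 2 => bondDartObservable (Λ δ) δ (1 / 3) c) =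
        fun c : Site 2 × Site 2 => cornerObs (Λ δ) δ c.1 c.2 := by
      funext c; rw [cornerObs_eq_bondDartObservable]
    rw [hfun, h]
  · rw [halfCRForm_apply]
    simp only [bondDartObservable_eq_zero_of_vanish (hvan p hp), sub_self, mul_zero]

/-! ## The signed MASTER identity at one mesh -/

/-- **The MASTER identity, summed over a finite vertex set** (cf. `sum_weight_expand`): with the weights
`w(p,k) = ∂̄φ(z_p) + i(−1)^{k+1} ∂φ(z_p) − (2(1−i)/δ)·coeff i k·φ(z_p)`,
`Σ_{p∈S} Σ_k w(p,k) Φ(c_{p,k}) = Σ_p ∂̄φ·Σ_kΦ + i Σ_p ∂φ·(Φ₁+Φ₃−Φ₀−Φ₂) − (2(1−i)/δ) Σ_p φ·halfCRForm i p Φ`. [folklore] -/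
theorem sum_master_expand (S : Finset (Site 2 × Fin 2)) (dbar del f : Site 2 × Fin 2 → ℂ) (c : ℂ)
    (Φ : Site 2 × Site 2 → ℂ) :
    ∑ p ∈ S, ∑ k : Fin 4, (dbar p + Complex.I * (-1) ^ (k.val + 1) * del p - c * coeff Complex.I k * f p) *
        Φ (medialCornersAt p.1 p.2 k) =
      ∑ p ∈ S, dbar p * ∑ k : Fin 4, Φ (medialCornersAt p.1 p.2 k) +
        Complex.I * ∑ p ∈ S, del p * (Φ (medialCornersAt p.1 p.2 1) + Φ (medialCornersAt p.1 p.2 3) -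
          Φ (medialCornersAt p.1 p.2 0) - Φ (medialCornersAt p.1 p.2 2)) -
        c * ∑ p ∈ S, f p * halfCRForm Complex.I p Φ := by
  rw [Finset.mul_sum, Finset.mul_sum, ← Finset.sum_add_distrib, ← Finset.sum_sub_distrib]
  refine Finset.sum_congr rfl fun p _ => ?_
  rw [sum_weight_expand]
  ring

/-! ## The equivalence at the level of one family and one test function -/

/-- **Weak holomorphy ⟺ weak Kirchhoff, per family and test function.** Along an admissible family `Λ` of `D` and for a
smooth test function `φ` compactly supported in `Ω`: `δ^{5/3} Σ_z F_δ(z) ∂̄φ(z_δ) → 0` iff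
`δ^{5/3} Σ_p ∂φ(z_p)·(Fd(NE)+Fd(SW)−Fd(NW)−Fd(SE))(p) → 0` (`Fd = bondDartObservable (Λ δ) δ (1/3)`,
`∂φ = (∂_xφ − i∂_yφ)/2`), because the two quantities differ, eventually, by `κ·δ^{5/3}·O(1)` (twin regrouping + Taylor) after
the exact vertex relation has removed the `φ/δ`-term. [cite: DuminilCopinSmirnov2012Lattice, Conjecture 8.7] -/
theorem weakKirchhoff_tendsto_iff (D : DobrushinDomain) (Λ : ℝ → DiscreteDobrushin) (hΛ : IsFamily D Λ) (φ : ℂ → ℂ)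
    (hφ : ContDiff ℝ (⊤ : ℕ∞) φ) (hc : HasCompactSupport φ) (hs : tsupport φ ⊆ D.carrier) :
    Tendsto (fun δ : ℝ => ((δ ^ ((5:ℝ) / 3) : ℝ) : ℂ) * ∑ᶠ z : MedialVertex,
        F Λ δ z * ((fderiv ℝ φ (medialPoint δ z) 1 + Complex.I * fderiv ℝ φ (medialPoint δ z) Complex.I) / 2))
      (𝓝[>] 0) (𝓝 0) ↔
    Tendsto (fun δ : ℝ => ((δ ^ ((5:ℝ) / 3) : ℝ) : ℂ) * ∑ᶠ p : Site 2 × Fin 2,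
        (fderiv ℝ φ (medialPoint δ (medialVertexOf p)) 1 -
            Complex.I * fderiv ℝ φ (medialPoint δ (medialVertexOf p)) Complex.I) / 2 *
          (bondDartObservable (Λ δ) δ (1 / 3) (medialCornersAt p.1 p.2 1) +
            bondDartObservable (Λ δ) δ (1 / 3) (medialCornersAt p.1 p.2 3) -
            bondDartObservable (Λ δ) δ (1 / 3) (medialCornersAt p.1 p.2 0) -
            bondDartObservable (Λ δ) δ (1 / 3) (medialCornersAt p.1 p.2 2)))
      (𝓝[>] 0) (𝓝 0) := by
  classical
  set K := tsupport φ with hKdef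
  have hK : IsCompact K := hc.isCompact
  have hKφ : ∀ z ∉ K, φ z = 0 := fun z hz => image_eq_zero_of_notMem_tsupport hz
  have hKd : ∀ z ∉ K, fderiv ℝ φ z = 0 := fun z hz => fderiv_of_notMem_tsupport ℝ hz
  obtain ⟨Cφ, hCφ⟩ := stub_calculus φ hφ hc
  obtain ⟨C', hC'⟩ := stub_taylorComb
  obtain ⟨CN, hCN⟩ := stub_count K hK
  -- abbreviations
  set zp : ℝ → Site 2 × Fin 2 → ℂ := fun δ p => medialPoint δ (medialVertexOf p) with hzp
  set dbar : ℂ → ℂ := fun z => (fderiv ℝ φ z 1 + Complex.I * fderiv ℝ φ z Complex.I) / 2 with hdbar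
  set del : ℂ → ℂ := fun z => (fderiv ℝ φ z 1 - Complex.I * fderiv ℝ φ z Complex.I) / 2 with hdel
  set Fd : ℝ → Site 2 × Site 2 → ℂ := fun δ c => bondDartObservable (Λ δ) δ (1 / 3) c with hFd_def
  set SK : ℝ → Site 2 × Fin 2 → ℂ := fun δ p =>
    Fd δ (medialCornersAt p.1 p.2 1) + Fd δ (medialCornersAt p.1 p.2 3) -
      Fd δ (medialCornersAt p.1 p.2 0) - Fd δ (medialCornersAt p.1 p.2 2) with hSK
  set X : ℝ → ℂ := fun δ => ((δ ^ ((5:ℝ) / 3) : ℝ) : ℂ) * ∑ᶠ z : MedialVertex,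
    F Λ δ z * ((fderiv ℝ φ (medialPoint δ z) 1 + Complex.I * fderiv ℝ φ (medialPoint δ z) Complex.I) / 2) with hX
  set Y : ℝ → ℂ := fun δ => ((δ ^ ((5:ℝ) / 3) : ℝ) : ℂ) * ∑ᶠ p : Site 2 × Fin 2, del (zp δ p) * SK δ p with hY
  have hdbar0 : ∀ z ∉ K, dbar z = 0 := fun z hz => by simp [hdbar, hKd z hz]
  have hdel0 : ∀ z ∉ K, del z = 0 := fun z hz => by simp [hdel, hKd z hz]
  have hFd : ∀ δ c, ‖Fd δ c‖ ≤ 1 := fun δ c => Parafermion.norm_bondDartObservable_le_one _ _ _ _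
  have hκ := kappa_pos_le
  -- ### Step 1: eventually, `X δ + κ i Y δ = κ δ^{5/3} ΣΣ w Fd`, of norm `≤ 2κ|C'Cφ||CN| δ^{5/3}`
  have hZ : ∀ᶠ δ in 𝓝[>] (0:ℝ), ‖X δ + (Summit.CriticalPhenomena.CardyFormulaZ2.Cruxes.ParafermionPrecompact.KenyonStreamSecondRelation.kappa : ℂ) * Complex.I * Y δ‖ ≤ 2 * |C' * Cφ| * |CN| * δ ^ ((5:ℝ) / 3) := by
    have E4 : ∀ᶠ δ in 𝓝[>] (0:ℝ), δ ∈ Set.Ioo (0:ℝ) 1 := Ioo_mem_nhdsGT one_pos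
    filter_upwards [finsum_eq_kappa_sum D Λ hΛ φ hc hs, halfCRForm_eq_zero_eventually D Λ hΛ K hK hs, E4]
      with δ h1 hR1 hδ
    have hδ0 : 0 < δ := hδ.1
    have hδ1 : δ ≤ 1 := hδ.2.le
    obtain ⟨S, hS, hcard⟩ := hCN δ hδ0 hδ1
    have hCN0 : 0 ≤ CN := le_trans (by positivity) hcard
    -- the weights at this mesh
    set w : Site 2 × Fin 2 → Fin 4 → ℂ := fun p k =>
      dbar (zp δ p) + Complex.I * (-1) ^ (k.val + 1) * del (zp δ p) -
        2 * (1 - Complex.I) / δ * coeff Complex.I k * φ (zp δ p) with hw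
    have hTk := hC' φ Cφ hCφ δ hδ0 hδ1
    have hsupp : ∀ (p : Site 2 × Fin 2) (k : Fin 4), w p k ≠ 0 → p ∈ S ∧ twin p.1 p.2 k ∈ S := by
      intro p k hne
      have hzK : zp δ p ∈ K := by
        by_contra hz
        apply hne
        simp [hw, hdbar0 _ hz, hdel0 _ hz, hKφ _ hz]
      refine ⟨hS p (Metric.self_subset_cthickening K hzK), hS _ ?_⟩
      refine Metric.mem_cthickening_of_dist_le _ (zp δ p) 1 K hzK ?_
      rw [dist_comm]
      exact ((hTk p k).1).trans hδ1
    -- (a) the MASTER bound on ΣΣ w Fd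
    have hmaster : ‖∑ p ∈ S, ∑ k : Fin 4, w p k * Fd δ (medialCornersAt p.1 p.2 k)‖ ≤
        2 * (|C' * Cφ| * δ ^ 2) * 1 * S.card :=
      master_norm_bound stub_regroup S w (Fd δ) (by positivity) zero_le_one hsupp
        (fun p _ k => ((hTk p k).2).trans (mul_le_mul_of_nonneg_right (le_abs_self _) (by positivity)))
        (fun p _ k => hFd δ _)
    have hmaster' : ‖∑ p ∈ S, ∑ k : Fin 4, w p k * Fd δ (medialCornersAt p.1 p.2 k)‖ ≤ 2 * |C' * Cφ| * |CN| := by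
      refine hmaster.trans ?_
      have : 2 * (|C' * Cφ| * δ ^ 2) * 1 * S.card = 2 * |C' * Cφ| * (δ ^ 2 * S.card) := by ring
      rw [this]
      exact mul_le_mul_of_nonneg_left (hcard.trans (le_abs_self _)) (by positivity)
    -- (b) the expansion, with the vertex-relation term zero
    have hexp := sum_master_expand S (fun p => dbar (zp δ p)) (fun p => del (zp δ p)) (fun p => φ (zp δ p))
      (2 * (1 - Complex.I) / δ) (Fd δ)
    have hR1sum : ∑ p ∈ S, φ (zp δ p) * halfCRForm Complex.I p (Fd δ) = 0 := by
      refine Finset.sum_eq_zero fun p _ => ?_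
      by_cases hzK : zp δ p ∈ K
      · rw [show halfCRForm Complex.I p (Fd δ) = 0 from hR1 p hzK, mul_zero]
      · rw [hKφ _ hzK, zero_mul]
    -- (c) the two finsums as sums over `S`
    have hYsum : ∑ᶠ p : Site 2 × Fin 2, del (zp δ p) * SK δ p = ∑ p ∈ S, del (zp δ p) * SK δ p := by
      refine finsum_eq_sum_of_support_subset _ fun p hp => ?_
      rw [Function.mem_support] at hp
      have hzK : zp δ p ∈ K := by
        by_contra hz
        exact hp (by rw [hdel0 _ hz, zero_mul])
      exact hS p (Metric.self_subset_cthickening K hzK)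
    have hident : X δ + (Summit.CriticalPhenomena.CardyFormulaZ2.Cruxes.ParafermionPrecompact.KenyonStreamSecondRelation.kappa : ℂ) * Complex.I * Y δ =
        (Summit.CriticalPhenomena.CardyFormulaZ2.Cruxes.ParafermionPrecompact.KenyonStreamSecondRelation.kappa : ℂ) * ((δ ^ ((5:ℝ) / 3) : ℝ) : ℂ) * ∑ p ∈ S, ∑ k : Fin 4, w p k * Fd δ (medialCornersAt p.1 p.2 k) := by
      simp only [hX, hY]
      rw [h1 S hS, hYsum, hexp, hR1sum]
      simp only [hSK, mul_zero, sub_zero]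
      ring
    rw [hident, norm_mul, norm_mul, Complex.norm_real, Complex.norm_real, Real.norm_of_nonneg hκ.1.le,
      Real.norm_of_nonneg (Real.rpow_nonneg hδ0.le _)]
    calc Summit.CriticalPhenomena.CardyFormulaZ2.Cruxes.ParafermionPrecompact.KenyonStreamSecondRelation.kappa * δ ^ ((5:ℝ) / 3) * ‖∑ p ∈ S, ∑ k : Fin 4, w p k * Fd δ (medialCornersAt p.1 p.2 k)‖
        ≤ 1 * δ ^ ((5:ℝ) / 3) * (2 * |C' * Cφ| * |CN|) :=
          mul_le_mul (mul_le_mul_of_nonneg_right hκ.2 (Real.rpow_nonneg hδ0.le _)) hmaster' (norm_nonneg _)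
            (by positivity)
      _ = 2 * |C' * Cφ| * |CN| * δ ^ ((5:ℝ) / 3) := by ring
  -- ### Step 2: hence `X + κ i Y → 0`
  have ht0 : Tendsto (fun δ : ℝ => 2 * |C' * Cφ| * |CN| * δ ^ ((5:ℝ) / 3)) (𝓝[>] (0:ℝ)) (𝓝 0) := by
    have hc' : Tendsto (fun δ : ℝ => δ ^ ((5:ℝ) / 3)) (𝓝 (0:ℝ)) (𝓝 ((0:ℝ) ^ ((5:ℝ) / 3))) :=
      (Real.continuousAt_rpow_const 0 ((5:ℝ) / 3) (Or.inr (by norm_num))).tendsto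
    rw [Real.zero_rpow (by norm_num)] at hc'
    simpa using (hc'.mono_left nhdsWithin_le_nhds).const_mul (2 * |C' * Cφ| * |CN|)
  have hZt : Tendsto (fun δ => X δ + (Summit.CriticalPhenomena.CardyFormulaZ2.Cruxes.ParafermionPrecompact.KenyonStreamSecondRelation.kappa : ℂ) * Complex.I * Y δ) (𝓝[>] (0:ℝ)) (𝓝 0) :=
    squeeze_zero_norm' hZ ht0
  have hκI : (Summit.CriticalPhenomena.CardyFormulaZ2.Cruxes.ParafermionPrecompact.KenyonStreamSecondRelation.kappa : ℂ) * Complex.I ≠ 0 := mul_ne_zero (by exact_mod_cast hκ.1.ne') Complex.I_ne_zero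
  -- ### Step 3: the equivalence
  change Tendsto X (𝓝[>] 0) (𝓝 0) ↔ Tendsto Y (𝓝[>] 0) (𝓝 0)
  constructor
  · intro hXt
    have h := (hZt.sub hXt).const_mul ((Summit.CriticalPhenomena.CardyFormulaZ2.Cruxes.ParafermionPrecompact.KenyonStreamSecondRelation.kappa : ℂ) * Complex.I)⁻¹
    simp only [sub_zero, mul_zero] at h
    refine h.congr' (Eventually.of_forall fun δ => ?_)
    rw [add_sub_cancel_left, ← mul_assoc, inv_mul_cancel₀ hκI, one_mul]
  · intro hYt
    have h := hZt.sub (hYt.const_mul ((Summit.CriticalPhenomena.CardyFormulaZ2.Cruxes.ParafermionPrecompact.KenyonStreamSecondRelation.kappa : ℂ) * Complex.I))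
    simp only [mul_zero, sub_zero] at h
    refine h.congr' (Eventually.of_forall fun δ => ?_)
    rw [add_sub_cancel_right]

/-- **The crux IS the weak Kirchhoff law.** `WeakHolomorphy` holds iff, along every admissible family of every Dobrushin
domain and for every smooth test function compactly supported in the domain,
`δ^{5/3} Σ_p ∂φ(z_p)·(Fd(NE)+Fd(SW)−Fd(NW)−Fd(SE))(p) → 0` as `δ → 0⁺` — the `∂φ`-tested (hence sublattice-staggered: the
smooth mode telescopes) Kirchhoff defect of the spin-`1/3` dart observable is `o(δ^{-5/3})` weakly.
[cite: DuminilCopinSmirnov2012Lattice, Conjecture 8.7] -/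
theorem weakHolomorphy_iff_weakKirchhoff :
    Summit.CriticalPhenomena.CardyFormulaZ2.Theses.CardySusyWard.WeakHolomorphy ↔
    ∀ (D : DobrushinDomain) (Λ : ℝ → DiscreteDobrushin), IsFamily D Λ → ∀ (φ : ℂ → ℂ),
      ContDiff ℝ (⊤ : ℕ∞) φ → HasCompactSupport φ → tsupport φ ⊆ D.carrier →
        Tendsto (fun δ : ℝ => ((δ ^ ((5:ℝ) / 3) : ℝ) : ℂ) * ∑ᶠ p : Site 2 × Fin 2,
            (fderiv ℝ φ (medialPoint δ (medialVertexOf p)) 1 -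
                Complex.I * fderiv ℝ φ (medialPoint δ (medialVertexOf p)) Complex.I) / 2 *
              (bondDartObservable (Λ δ) δ (1 / 3) (medialCornersAt p.1 p.2 1) +
                bondDartObservable (Λ δ) δ (1 / 3) (medialCornersAt p.1 p.2 3) -
                bondDartObservable (Λ δ) δ (1 / 3) (medialCornersAt p.1 p.2 0) -
                bondDartObservable (Λ δ) δ (1 / 3) (medialCornersAt p.1 p.2 2)))
          (𝓝[>] 0) (𝓝 0) := by
  constructor
  · intro h D Λ hΛ φ hφ hc hs
    obtain ⟨h1, h2, h3, h4, h5, h6⟩ := hΛ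
    exact (weakKirchhoff_tendsto_iff D Λ ⟨h1, h2, h3, h4, h5, h6⟩ φ hφ hc hs).1 (h D Λ h1 h2 h3 h4 h5 h6 φ hφ hc hs)
  · intro h D Λ h1 h2 h3 h4 h5 h6 φ hφ hc hs
    exact (weakKirchhoff_tendsto_iff D Λ ⟨h1, h2, h3, h4, h5, h6⟩ φ hφ hc hs).2 (h D Λ ⟨h1, h2, h3, h4, h5, h6⟩ φ hφ hc hs)

/-- **Registered one-line form of `weakHolomorphy_iff_weakKirchhoff`**: the crux `WeakHolomorphy` is EQUIVALENT to the
weak (`∂φ`-tested) Kirchhoff law of the spin-`1/3` dart observable at the rate `o(δ^{-5/3})`.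
[cite: DuminilCopinSmirnov2012Lattice, Conjecture 8.7] -/
theorem stub_weakHolomorphyIffWeakKirchhoff : Summit.CriticalPhenomena.CardyFormulaZ2.Theses.CardySusyWard.WeakHolomorphy ↔ ∀ (D : DobrushinDomain) (Λ : ℝ → DiscreteDobrushin), IsFamily D Λ → ∀ (φ : ℂ → ℂ), ContDiff ℝ (⊤ : ℕ∞) φ → HasCompactSupport φ → tsupport φ ⊆ D.carrier → Tendsto (fun δ : ℝ => ((δ ^ ((5:ℝ) / 3) : ℝ) : ℂ) * ∑ᶠ p : Site 2 × Fin 2, (fderiv ℝ φ (medialPoint δ (medialVertexOf p)) 1 - Complex.I * fderiv ℝ φ (medialPoint δ (medialVertexOf p)) Complex.I) / 2 * (bondDartObservable (Λ δ) δ (1 / 3) (medialCornersAt p.1 p.2 1) + bondDartObservable (Λ δ) δ (1 / 3) (medialCornersAt p.1 p.2 3) - bondDartObservable (Λ δ) δ (1 / 3) (medialCornersAt p.1 p.2 0) - bondDartObservable (Λ δ) δ (1 / 3) (medialCornersAt p.1 p.2 2))) (𝓝[>] 0) (𝓝 0) :=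
  weakHolomorphy_iff_weakKirchhoff

end Summit.CriticalPhenomena.CardyFormulaZ2.Theorems.WeakHolomorphy.SplitBypass

end
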